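import Summits.QuantumFields.YangMills.Theorems.MirrorModularBoostsSoftKernelBoostCovarianceConeFamily
import HarnessLib

/-!
# Line `TwoGapPlanarCone` — G1 next-rung over the landed floor `PlanarSpectralCone` (item 9664)

Crux host: `MirrorModularBoosts.SoftKernelBoostCovariance` (stmt-QuantumFields-14999), route
`route-QuantumFields-MirrorModularBoosts`; generator G1 `next-rung`, unit `fwd-rung-QuantumFields-02`.

**Graded family** `PlanarConeRung : ℕ → Prop` — parameter `k` = number of independently moved complex
PLANAR gaps `w = (ζ, β)` (`ζ` = complex time, `β` = complex translation along `e₁`) in a reflection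
pairing of time-ordered blocks, each gap ranging over the planar tube `𝒯 = {|Im β| < Re ζ}`:

* member `0` (one gap) **is the floor verbatim, BY NAME**:
  `Summit.QuantumFields.YangMills.Theses.MirrorModularBoosts.PlanarSpectralCone` (item 9664, proved by
  `…PositivityDiscToOperatorCone.PlanarSpectralCone_of`; witness `example : PlanarConeRung 0` below);
* member `1` (two gaps) is the **rung** `TwoGapPlanarCone`: for time-ordered blocks `F | I | G` with the
  insertion `I` supported at times `< T`, the Schwinger function of `ΘF* ⊗ (I ⊗ G_{(t₂,b₂)})_{(t₁,b₁)}`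
  is the restriction to the real points `t₁ > 0, t₂ > T` of ONE function holomorphic on
  `𝒯 × 𝒯_T`, `𝒯_T = {|Im β| + T < Re ζ}` (both gaps complex AT ONCE).

**Why the floor's proof stops here (located failure point).** `PlanarSpectralCone_of`
(`Theorems/MirrorModularBoostsPlanarSpectralCone.lean` l.391–397) is `stub_transfer` over the operator cone:
`Φ(w) = ⟪Ψ_F, N(w) Ψ_G⟫` with the contraction family `N(t,b) = e^{-tH}U(b e₁)`
(`…PlanarSpectralConeTransfer.lean`, `contractionFamily`, l.178; packaged as operators in
`Theorems/…SoftKernelBoostCovarianceConeFamily.lean`, `stub_coneFamily`).  With a second complex gap BEHIND an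
insertion the same move needs the INSERTED vector `w₂ ↦ Ψ_{I ⊗ G_{w₂}}` as a holomorphic `ℋ`-valued function
of the PLANAR variable `w₂ ∈ 𝒯_T`; the tree has inserted vectors only in the complex TIME variable on the
`π/4`-sector (`OneGap.exists_holomorphic_stretch`, l.75 ff., via `exists_sector_extension` +
`exists_holomorphic_gramVec (m := 1)`), and `e^{iβP₁}` cannot be commuted past the insertion (it produces
complex spatial translates of `I`).  NEW IDEA NEEDED: the Osterwalder–Schrader II Ch. V.2 induction
`(A_N) ⇒ (P_N) ⇒ (A_{N+1})` (tree: `OSLabelledStep`, `OSEnvelopeBases`) transplanted from the half-line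
semigroup `e^{-τH}` to the cone semigroup `N(u,v) = e^{-uA} e^{-vB}`, `A = (H - P₁)/2`, `B = (H + P₁)/2`
(light-cone variables `u = ζ + iβ`, `v = ζ - iβ`, `𝒯 ≅ ℂ₊ × ℂ₊`), re-based on the Euclidean slice `v = ū`
(a totally real slice, not the positive orthant): stub `stub_insertedPlanarVector`.

**Stubs** (sorries ONLY here): `stub_insertedPlanarVector` (the heart, XL), `stub_sandwichHolomorphy`
(abstract functional analysis, M: Dunford weak⇒strong + Osgood, tree files `Literature/Analysis/Complex/WeakHolomorphy`,
`OsgoodSeparate`).  In-tree inputs used BY NAME in the composition: `osReconstruction_e0`, `stub_coneFamily`.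
Composition `TwoGapPlanarCone_of : stub₁ → stub₂ → TwoGapPlanarCone` is kernel-checked (no sorry).

FORWARD: generator=next-rung; lens_report=forward-generator;
parent_route=route-QuantumFields-MirrorModularBoosts; host_crux=stmt-QuantumFields-14999
-/

noncomputable section

namespace Summit.QuantumFields.YangMills.Cruxes.SoftKernelBoostCovariance.TwoGapPlanarCone

open MeasureTheory
open scoped InnerProductSpace SchwartzMap
open Literature.MathematicalPhysics.QuantumLattice Literature.MathematicalPhysics.AQFT
  Literature.MathematicalPhysics.QuantumFieldTheory
open Summit.QuantumFields.YangMills.Cruxes.PlanarSpectralCone.PositivityDiscToOperatorCone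
  (osReconstruction_e0)
open Summit.QuantumFields.YangMills.Theorems.SoftKernelBoostCovariance.Sketch (stub_coneFamily)

local notation "E4" => EuclideanSpace ℝ (Fin 4)

set_option linter.dupNamespace false in
/-- **RUNG (member 1 of `PlanarConeRung`): two complex planar gaps at once.**  Same hypotheses as the floor
`MirrorModularBoosts.PlanarSpectralCone` (one-species family on `ℝ⁴`; E0', E3, translations on `⁰𝒮`, RP in the
four planar frames).  For time-ordered `F` (arity `n`), an insertion `I` (arity `q`) time-ordered and supported
at times `< T` (`T > 0`), and time-ordered `G` (arity `m`): there is `Φ` holomorphic on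
`{(w₁, w₂) : |Im β₁| < Re ζ₁, |Im β₂| + T < Re ζ₂}` (`wᵢ = (ζᵢ, βᵢ)`) whose value at the real points
`t₁ > 0, t₂ > T` is `𝔖(ΘF* ⊗ K_{(t₁,b₁)})` for every time-ordered witness `K` of `I ⊗ G_{(t₂,b₂)}`
(translation by `t e₀ + b e₁`). -/
def TwoGapPlanarCone : Prop :=
  ∀ (S : SchwingerFamily E4), S.toLabelled.HasLinearGrowth → S.toLabelled.IsSymmetric →
    (∀ (n : ℕ) (a : E4) (F : 𝓢((Fin n → E4), ℂ)), IsOffDiagonal F →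
      S n (translateMulti a F) = S n F) →
    (∀ (R : E4 ≃ₗᵢ[ℝ] E4) (a b : ℝ), a ^ 2 + b ^ 2 = 1 → (a = 0 ∨ b = 0 ∨ a ^ 2 = b ^ 2) →
      R (EuclideanSpace.single 0 1) = a • EuclideanSpace.single 0 1 + b • EuclideanSpace.single 1 1 →
        (SchwingerFamily.toLabelled (fun n => (S n).comp (linActMulti R))).IsReflectionPositive) →
    ∀ (n q m : ℕ) (F : 𝓢((Fin n → E4), ℂ)) (I : 𝓢((Fin q → E4), ℂ)) (G : 𝓢((Fin m → E4), ℂ))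
      (T : ℝ), 0 < T → IsTimeOrdered F → IsTimeOrdered I →
      tsupport (I : (Fin q → E4) → ℂ) ⊆ {x | ∀ i, x i 0 < T} → IsTimeOrdered G →
      ∃ Φ : (ℂ × ℂ) × (ℂ × ℂ) → ℂ,
        DifferentiableOn ℂ Φ
          {p : (ℂ × ℂ) × (ℂ × ℂ) | |p.1.2.im| < p.1.1.re ∧ |p.2.2.im| + T < p.2.1.re} ∧
        ∀ (t₁ b₁ t₂ b₂ : ℝ), 0 < t₁ → T < t₂ →
          ∀ (K : 𝓢((Fin (q + m) → E4), ℂ)), IsTimeOrdered K →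
            IsAppendTensorOf K I
              (translateMulti (t₂ • EuclideanSpace.single 0 1 + b₂ • EuclideanSpace.single 1 1) G) →
            ∀ (H : 𝓢((Fin (n + (q + m)) → E4), ℂ)),
              IsAppendTensorOf H (osAdjoint F)
                (translateMulti (t₁ • EuclideanSpace.single 0 1 + b₁ • EuclideanSpace.single 1 1) K) →
              Φ (((t₁ : ℂ), (b₁ : ℂ)), ((t₂ : ℂ), (b₂ : ℂ))) = S (n + (q + m)) H

/-- **The graded family** (parameter `k + 1` = number of complex planar gaps moved at once): member `0` is the
floor BY NAME, member `1` (and, until the `k`-uniform statement is typed, every later index) the rung. -/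
def PlanarConeRung : ℕ → Prop
  | 0 => Summit.QuantumFields.YangMills.Theses.MirrorModularBoosts.PlanarSpectralCone
  | _ + 1 => TwoGapPlanarCone

/-- Member `0` of the family is literally the floor. -/
theorem planarConeRung_zero :
    PlanarConeRung 0 = Summit.QuantumFields.YangMills.Theses.MirrorModularBoosts.PlanarSpectralCone := rfl

/-- Member `1` of the family is literally the rung. -/
theorem planarConeRung_one : PlanarConeRung 1 = TwoGapPlanarCone := rfl

/-- **WITNESS (F1 (c))**: the family at the floor's parameter is closed by the seed theorem, by name. -/
example : PlanarConeRung 0 := by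
  simpa [PlanarConeRung] using
    Summit.QuantumFields.YangMills.Cruxes.PlanarSpectralCone.PositivityDiscToOperatorCone.PlanarSpectralCone_of

/-! ## The two stubs -/

/-- **STUB 1 (the heart, XL) — inserted planar vectors.**  In the `e₀`-reconstruction `h` of a family with the
floor's hypotheses, for an insertion `I` (time-ordered, times `< T`) and a time-ordered tail `G`, the field vector
of `I ⊗ G_{(t,b)}` is the value at the real points `t > T` of ONE `ℋ`-valued function holomorphic on the shifted
planar tube `{|Im b| + T < Re t}`.  (OS II Ch. V.2 induction over the cone semigroup in light-cone variables,
re-based on the Euclidean slice; first move of a lead: split into the symmetric two-gap continuation of the Gram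
kernel `⟪Ψ_{I⊗G_{w'}}, Ψ_{I⊗G_{w}}⟫` and `exists_holomorphic_gramVec`.)  Why it might fail: the re-based
induction may exhaust a proper sub-domain of `𝒯_T` only (natural boundary for some 4-frame-RP non-Gaussian
family); sources: Osterwalder–Schrader CMP 42 (1975) Thm 4.1–4.2, Ch. V; Glimm–Jaffe (1987) §19.5. -/
theorem stub_insertedPlanarVector :
    ∀ (S : SchwingerFamily E4) (h : OSReconstructionNoE1 S.toLabelled),
      S.toLabelled.HasLinearGrowth → S.toLabelled.IsSymmetric →
      (∀ (n : ℕ) (a : E4) (F : 𝓢((Fin n → E4), ℂ)), IsOffDiagonal F →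
        S n (translateMulti a F) = S n F) →
      (∀ (R : E4 ≃ₗᵢ[ℝ] E4) (a b : ℝ), a ^ 2 + b ^ 2 = 1 → (a = 0 ∨ b = 0 ∨ a ^ 2 = b ^ 2) →
        R (EuclideanSpace.single 0 1) = a • EuclideanSpace.single 0 1 + b • EuclideanSpace.single 1 1 →
          (SchwingerFamily.toLabelled (fun n => (S n).comp (linActMulti R))).IsReflectionPositive) →
      ∀ (q m : ℕ) (I : 𝓢((Fin q → E4), ℂ)) (G : 𝓢((Fin m → E4), ℂ)) (T : ℝ), 0 < T →
        IsTimeOrdered I → tsupport (I : (Fin q → E4) → ℂ) ⊆ {x | ∀ i, x i 0 < T} → IsTimeOrdered G →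
        ∃ V : ℂ × ℂ → h.Hilbert,
          DifferentiableOn ℂ V {w : ℂ × ℂ | |w.2.im| + T < w.1.re} ∧
          ∀ (t b : ℝ), T < t → ∀ (K : 𝓢((Fin (q + m) → E4), ℂ)) (hK : IsTimeOrdered K),
            IsAppendTensorOf K I
              (translateMulti (t • EuclideanSpace.single 0 1 + b • EuclideanSpace.single 1 1) G) →
            V ((t : ℂ), (b : ℂ)) = h.fieldVec (q + m) (fun _ => ()) K hK := by
  sorry

/-- **STUB 2 (M) — joint holomorphy of a sandwich.**  For a contraction-valued, weakly holomorphic operator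
family `N` on an open `D₁ ⊆ ℂ²` (the shape delivered by `stub_coneFamily`) and an `ℋ`-valued holomorphic `V` on an
open `D₂ ⊆ ℂ²`, every matrix element `(w₁, w₂) ↦ ⟪x, N(w₁) V(w₂)⟫` is jointly holomorphic on `D₁ × D₂`
(Dunford: weak + locally bounded ⇒ strong holomorphy of `w₁ ↦ N(w₁) y`; Osgood: separately holomorphic +
continuous ⇒ holomorphic).  Why it might fail: only by a typing slip — the mathematics is classical
(`Literature/Analysis/Complex/WeakHolomorphy`, `OsgoodSeparate`). -/
theorem stub_sandwichHolomorphy :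
    ∀ {H : Type} [NormedAddCommGroup H] [InnerProductSpace ℂ H] [CompleteSpace H]
      (N : ℂ × ℂ → (H →L[ℂ] H)) (D₁ D₂ : Set (ℂ × ℂ)), IsOpen D₁ → IsOpen D₂ →
      (∀ p ∈ D₁, ‖N p‖ ≤ 1) →
      (∀ x y : H, DifferentiableOn ℂ (fun p : ℂ × ℂ => ⟪x, N p y⟫_ℂ) D₁) →
      ∀ (V : ℂ × ℂ → H), DifferentiableOn ℂ V D₂ →
        ∀ x : H, DifferentiableOn ℂ (fun p : (ℂ × ℂ) × (ℂ × ℂ) => ⟪x, N p.1 (V p.2)⟫_ℂ)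
          {p : (ℂ × ℂ) × (ℂ × ℂ) | p.1 ∈ D₁ ∧ p.2 ∈ D₂} := by
  sorry

/-! ## Elementary facts used by the composition -/

/-- The planar tube is open. -/
theorem isOpen_tube : IsOpen {w : ℂ × ℂ | |w.2.im| < w.1.re} := by
  have h1 : Continuous fun w : ℂ × ℂ => |w.2.im| := by fun_prop
  have h2 : Continuous fun w : ℂ × ℂ => w.1.re := by fun_prop
  exact isOpen_lt h1 h2

/-- The shifted planar tube is open. -/
theorem isOpen_shiftedTube (T : ℝ) : IsOpen {w : ℂ × ℂ | |w.2.im| + T < w.1.re} := by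
  have h1 : Continuous fun w : ℂ × ℂ => |w.2.im| + T := by fun_prop
  have h2 : Continuous fun w : ℂ × ℂ => w.1.re := by fun_prop
  exact isOpen_lt h1 h2

/-! ## The composition: stubs ⇒ rung, by name -/

/-- **THE RUNG FROM THE LINE, BY NAME**: `TwoGapPlanarCone` from the two stubs and the tree (the `e₀`-OS space
`osReconstruction_e0`, the landed operator cone family `stub_coneFamily`): `Φ(w₁, w₂) = ⟪Ψ_F, N(w₁) V(w₂)⟫`. -/
theorem TwoGapPlanarCone_of
    (h_vec : ∀ (S : SchwingerFamily E4) (h : OSReconstructionNoE1 S.toLabelled),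
      S.toLabelled.HasLinearGrowth → S.toLabelled.IsSymmetric →
      (∀ (n : ℕ) (a : E4) (F : 𝓢((Fin n → E4), ℂ)), IsOffDiagonal F →
        S n (translateMulti a F) = S n F) →
      (∀ (R : E4 ≃ₗᵢ[ℝ] E4) (a b : ℝ), a ^ 2 + b ^ 2 = 1 → (a = 0 ∨ b = 0 ∨ a ^ 2 = b ^ 2) →
        R (EuclideanSpace.single 0 1) = a • EuclideanSpace.single 0 1 + b • EuclideanSpace.single 1 1 →
          (SchwingerFamily.toLabelled (fun n => (S n).comp (linActMulti R))).IsReflectionPositive) →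
      ∀ (q m : ℕ) (I : 𝓢((Fin q → E4), ℂ)) (G : 𝓢((Fin m → E4), ℂ)) (T : ℝ), 0 < T →
        IsTimeOrdered I → tsupport (I : (Fin q → E4) → ℂ) ⊆ {x | ∀ i, x i 0 < T} → IsTimeOrdered G →
        ∃ V : ℂ × ℂ → h.Hilbert,
          DifferentiableOn ℂ V {w : ℂ × ℂ | |w.2.im| + T < w.1.re} ∧
          ∀ (t b : ℝ), T < t → ∀ (K : 𝓢((Fin (q + m) → E4), ℂ)) (hK : IsTimeOrdered K),
            IsAppendTensorOf K I
              (translateMulti (t • EuclideanSpace.single 0 1 + b • EuclideanSpace.single 1 1) G) →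
            V ((t : ℂ), (b : ℂ)) = h.fieldVec (q + m) (fun _ => ()) K hK)
    (h_sand : ∀ {H : Type} [NormedAddCommGroup H] [InnerProductSpace ℂ H] [CompleteSpace H]
      (N : ℂ × ℂ → (H →L[ℂ] H)) (D₁ D₂ : Set (ℂ × ℂ)), IsOpen D₁ → IsOpen D₂ →
      (∀ p ∈ D₁, ‖N p‖ ≤ 1) →
      (∀ x y : H, DifferentiableOn ℂ (fun p : ℂ × ℂ => ⟪x, N p y⟫_ℂ) D₁) →
      ∀ (V : ℂ × ℂ → H), DifferentiableOn ℂ V D₂ →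
        ∀ x : H, DifferentiableOn ℂ (fun p : (ℂ × ℂ) × (ℂ × ℂ) => ⟪x, N p.1 (V p.2)⟫_ℂ)
          {p : (ℂ × ℂ) × (ℂ × ℂ) | p.1 ∈ D₁ ∧ p.2 ∈ D₂}) :
    TwoGapPlanarCone := by
  intro S hlg hsym htr hRP n q m F I G T hT hF hI hIT hG
  have h : OSReconstructionNoE1 S.toLabelled := osReconstruction_e0 S htr hRP
  obtain ⟨N, hNb, hNd, hNr⟩ := stub_coneFamily S h hlg hsym htr hRP
  obtain ⟨V, hVd, hVr⟩ := h_vec S h hlg hsym htr hRP q m I G T hT hI hIT hG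
  refine ⟨fun p => ⟪h.fieldVec n (fun _ => ()) F hF, N p.1 (V p.2)⟫_ℂ, ?_, ?_⟩
  · exact h_sand N {w : ℂ × ℂ | |w.2.im| < w.1.re} {w : ℂ × ℂ | |w.2.im| + T < w.1.re}
      isOpen_tube (isOpen_shiftedTube T) (fun p hp => hNb p hp) hNd V hVd _
  · intro t₁ b₁ t₂ b₂ ht₁ ht₂ K hK hKI H hH
    show ⟪h.fieldVec n (fun _ => ()) F hF, N ((t₁ : ℂ), (b₁ : ℂ)) (V ((t₂ : ℂ), (b₂ : ℂ)))⟫_ℂ =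
      S (n + (q + m)) H
    rw [hVr t₂ b₂ ht₂ K hK hKI, hNr t₁ b₁ ht₁, OSReconstructionNoE1.translate_fieldVec,
      OSReconstructionNoE1.transfer_fieldVec _ ht₁.le]
    have hH' : IsAppendTensorOf H (osAdjoint F) (translateMulti (SchwingerFamily.timeVec t₁)
        (translateMulti (spatialPart 0 (b₁ • (EuclideanSpace.single 1 1 : E4))) K)) := by
      rw [Summit.QuantumFields.YangMills.Cruxes.PlanarSpectralCone.TwoMirrorLightconeSlots.DiscSections.translateMulti_time_space]
      exact hH
    rw [h.inner_fieldVec_fieldVec (fun _ => ()) (fun _ => ()) hF _ hH']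
    rfl

end Summit.QuantumFields.YangMills.Cruxes.SoftKernelBoostCovariance.TwoGapPlanarCone

end
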